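import Literature.NumberTheory.Automorphic.QuaternionAlgebraExistenceReciprocity
import Literature.NumberTheory.QuadraticForms.HilbertReciprocityProofs
import Literature.NumberTheory.QuadraticForms.SUnitSquareClassesProofs
import Literature.NumberTheory.QuadraticForms.HasseNormTheoremHolds
import HarnessLib

/-!
# Hilbert reciprocity and the existence of quaternion algebras with prescribed ramification,
# reduced to O'Meara 71:17 alone

Topic `NumberTheory/Automorphic` (with one declaration in `Literature.NumberTheory.QuadraticForms`);
all declarations fully proved. No new named fact (D-0026).

`Literature/NumberTheory/QuadraticForms/HilbertReciprocityProofs.lean` proves Hilbert's reciprocity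
law `∏_𝔭 (a, b)_𝔭 = 1` (O'Meara Thm. 71:18, the named fact `hilbertReciprocity K a b`) from three
inputs (`hilbertReciprocity_of_hasseNorm`):

1. the second inequality `(J_K : P_K N_{E/K} J_E) ∣ 2` for quadratic `E/K`
   (`normIdeles_index_dvd_two K`, O'Meara 65:21);
2. Hasse's norm theorem for the quadratic extensions of the finite extensions of `K`
   (`Automorphic.hilbertSymbol_eq_one_of_forall_completions L c d`, O'Meara 65:23);
3. O'Meara 71:17 (`range_localUnits_not_le_of_inertiaDegIn_eq_two K`): at a finite place `𝔮`
   inert in the quadratic extension `E/K`, the `𝔮`-idèles are not contained in `P_K · N_{E/K} J_E`.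

Inputs 1 and 2 are now theorems of the tree (`normIdeles_index_dvd_two_holds`,
`SUnitSquareClassesProofs.lean`; `hilbertSymbol_eq_one_of_forall_completions_holds`,
`HasseNormTheoremHolds.lean`, both along O'Meara §65). This file records the resulting one-input
reductions:

* `Literature.NumberTheory.QuadraticForms.hilbertReciprocity_of_inert` — **71:18 from 71:17**;
* `exists_isQuaternionAlgebra_of_even_of_inert` — the existence half of Vignéras III Thm. 3.1
  (the named fact `exists_isQuaternionAlgebra_of_even K` of `QuaternionAlgebraAdelic.lean`: for
  `|S| + |T|` even there is a quaternion algebra over `K` ramified exactly at `S ∪ T`) from 71:17,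
  through `exists_isQuaternionAlgebra_of_even_of_hilbertReciprocity`
  (`QuaternionAlgebraExistenceReciprocity.lean`: O'Meara 71:19 and `D = (a, θ / K)`);
* `even_card_ramified_of_inert` — the parity half of Vignéras III Thm. 3.1 (the named fact
  `even_card_ramified K D`) from 71:17 (`even_card_ramified_of_hilbertReciprocity`,
  `QuaternionRamificationParity.lean`).

So the residual class-field-theoretic content of Vignéras III Thm. 3.1 (existence and parity; the
uniqueness half is the theorem `nonempty_algEquiv_of_ramifiedPlaces_eq_holds`) is exactly O'Meara
71:17, whose printed proof is the ten-field construction §71C (71:14–71:16) over the cyclotomic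
reciprocity 71:12.

## References

* O. T. O'Meara, *Introduction to quadratic forms*, Grundlehren 117, Springer (1963), §71C
  Prop. 71:17, §71D Thm. 71:18, 71:19 (PDF pp. 206–208 of the held copy).
* M.-F. Vignéras, *Arithmétique des algèbres de quaternions*, LNM 800 (1980), Ch. III §3
  Thm. 3.1.
-/

noncomputable section

namespace Literature.NumberTheory.QuadraticForms

/-- **Hilbert's reciprocity law (O'Meara 71:18) from O'Meara 71:17 alone**: for a number field `K`,
if for every quadratic extension `E = K(α)`, `α² = θ`, and every finite place `𝔮` of `K` with
inertia degree `2` in `E` the `𝔮`-idèles are not contained in `P_K · N_{E/K} J_E`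
(`range_localUnits_not_le_of_inertiaDegIn_eq_two K`), then `∏_𝔭 (a, b)_𝔭 = 1` for all
`a b ∈ Kˣ` (`hilbertReciprocity K a b`). This is `hilbertReciprocity_of_hasseNorm` with its first
two inputs — the second inequality 65:21 and Hasse's norm theorem 65:23 over the finite extensions of
`K` — supplied by the theorems `normIdeles_index_dvd_two_holds` and
`Automorphic.hilbertSymbol_eq_one_of_forall_completions_holds`.
[cite: Omeara1963, §71D Thm. 71:18] -/
theorem hilbertReciprocity_of_inert (K : Type) [Field K] [NumberField K]
    (h17 : range_localUnits_not_le_of_inertiaDegIn_eq_two K) (a b : K) :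
    hilbertReciprocity K a b :=
  hilbertReciprocity_of_hasseNorm K (normIdeles_index_dvd_two_holds K)
    (fun L _ _ _ c d ↦ Automorphic.hilbertSymbol_eq_one_of_forall_completions_holds L c d) h17 a b

end Literature.NumberTheory.QuadraticForms

namespace Literature.NumberTheory.Automorphic

universe u

/-- **Vignéras III Thm. 3.1 (existence) from O'Meara 71:17**: if at every finite place inert in a
quadratic extension `E/K` the local idèles escape `P_K · N_{E/K} J_E`
(`QuadraticForms.range_localUnits_not_le_of_inertiaDegIn_eq_two K`), then for all finite sets `S`
of finite places and `T` of real places of `K` with `|S| + |T|` even there is a quaternion algebra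
over `K` ramified exactly at `S` and `T` (the named fact `exists_isQuaternionAlgebra_of_even K`).
Hilbert reciprocity (`QuadraticForms.hilbertReciprocity_of_inert`) fed into
`exists_isQuaternionAlgebra_of_even_of_hilbertReciprocity` (O'Meara 71:19, `D = (a, θ / K)`).
[cite: VignerasLNM800, Ch. III §3 Thm. 3.1] -/
theorem exists_isQuaternionAlgebra_of_even_of_inert (K : Type) [Field K] [NumberField K]
    (h17 : QuadraticForms.range_localUnits_not_le_of_inertiaDegIn_eq_two K) :
    exists_isQuaternionAlgebra_of_even K :=
  exists_isQuaternionAlgebra_of_even_of_hilbertReciprocity K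
    (QuadraticForms.hilbertReciprocity_of_inert K h17)

/-- **Vignéras III Thm. 3.1 (parity) from O'Meara 71:17**: under the same single hypothesis, a
quaternion algebra `D` over `K` is ramified at an even number of places (the named fact
`even_card_ramified K D` of `QuaternionAlgebraAdelic.lean`), by
`even_card_ramified_of_hilbertReciprocity`. [cite: VignerasLNM800, Ch. III §3 Thm. 3.1] -/
theorem even_card_ramified_of_inert (K : Type) [Field K] [NumberField K]
    (D : Type u) [Ring D] [Algebra K D]
    (h17 : QuadraticForms.range_localUnits_not_le_of_inertiaDegIn_eq_two K) :
    even_card_ramified K D :=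
  even_card_ramified_of_hilbertReciprocity K D (QuadraticForms.hilbertReciprocity_of_inert K h17)

end Literature.NumberTheory.Automorphic
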